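import Literature.NumberTheory.Transcendental.KZCalculusProofs
import Literature.NumberTheory.Transcendental.KZCubicalCalculus

/-!
# Sketch — crux idea `kollar-principalization-atlas` (crux stmt-KontsevichZagierPeriods-3814, piece X₁ `CubeResolution`)

First lemma of the line (it must elaborate; it is not proved here): the RULES BOOKKEEPING of a
rectilinearising atlas — if a bounded body `∫_K 1` is covered almost everywhere by finitely many
injective `ℚ`-semialgebraic differentiable charts of the open unit cube with a.e.-disjoint images inside
`K`, whose Jacobian determinants agree on the open cube with functions real analytic on a neighbourhood
of the CLOSED cube, then `[K]` is congruent modulo `KZ.relations` to a `ℤ`-combination of tame cube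
classes (one rule-(2) move per chart, rule (1a) across the null complements and the null faces). The
EXISTENCE of such an atlas for every bounded `ℚ`-semialgebraic solid is the transfer target: Kollár's
order reduction for marked ideals in characteristic zero (named fact `Kollar2007MarkedOrderReduction` of
`Literature/AlgebraicGeometry/Resolution`, ⇒ principalization of the ideal of the Zariski closure of
`∂K` in `𝔸ⁿ_ℚ` by blow-ups in smooth `ℚ`-centres) read on real points.
-/

noncomputable section

namespace Summit.KontsevichZagierPeriods.SphericalSchlafli.VolumeForm.KollarAtlas

open Set MeasureTheory
open Literature.NumberTheory.Transcendental
open Literature.NumberTheory.Transcendental.KZ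

/-- The open unit cube `(0,1)ᵐ`. -/
def openCube (m : ℕ) : Set (Fin m → ℝ) := {x | ∀ i, 0 < x i ∧ x i < 1}

/-- A RECTILINEARISING ATLAS of a set `D ⊆ ℝᵐ`: finitely many charts `φ j` of the open unit cube,
`ℚ`-semialgebraic, injective, differentiable within the open cube with derivative `φ' j`, images inside
`D`, pairwise almost disjoint and covering `D` up to a null set, each Jacobian determinant agreeing on the
open cube with a function real analytic on a neighbourhood of the closed cube `KZ.cube m`. -/
def IsRectilinearAtlas {m : ℕ} (D : Set (Fin m → ℝ)) (J : ℕ)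
    (φ : Fin J → (Fin m → ℝ) → (Fin m → ℝ))
    (φ' : Fin J → (Fin m → ℝ) → (Fin m → ℝ) →L[ℝ] (Fin m → ℝ)) : Prop :=
  (∀ j, IsSemialgebraicMapOn ℚ (openCube m) (φ j)) ∧
  (∀ j, ∀ x ∈ openCube m, HasFDerivWithinAt (φ j) (φ' j x) (openCube m) x) ∧
  (∀ j, InjOn (φ j) (openCube m)) ∧
  (∀ j, φ j '' openCube m ⊆ D) ∧
  (∀ j j', j ≠ j' → volume (φ j '' openCube m ∩ φ j' '' openCube m) = 0) ∧
  volume (D \ ⋃ j, φ j '' openCube m) = 0 ∧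
  (∀ j, ∃ g : (Fin m → ℝ) → ℝ, AnalyticOnNhd ℝ g (KZ.cube m) ∧
    ∀ x ∈ openCube m, |(φ' j x).det| = g x)

/-- **FIRST LEMMA (rules bookkeeping, M; provable now)**: a bounded body with a rectilinearising atlas
is congruent modulo `KZ.relations` to a `ℤ`-combination of tame cube classes. -/
def AtlasToTame : Prop :=
  ∀ (m : ℕ) (K : IntegralRep m), Bornology.IsBounded K.domain → (∀ x ∈ K.domain, K.integrand x = 1) →
    ∀ (J : ℕ) (φ : Fin J → (Fin m → ℝ) → (Fin m → ℝ))
      (φ' : Fin J → (Fin m → ℝ) → (Fin m → ℝ) →L[ℝ] (Fin m → ℝ)),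
      IsRectilinearAtlas K.domain J φ φ' →
      ∃ c ∈ AddSubgroup.closure {d : FormalRep | ∃ (n : ℕ) (r : IntegralRep n),
          r.domain = KZ.cube n ∧ AnalyticOnNhd ℝ r.integrand (KZ.cube n) ∧ d = of r},
        of K - c ∈ relations

/-- **TRANSFER TARGET (XL; the hard stub)**: every bounded `ℚ`-semialgebraic solid of dimension `≥ 3`
carries a rectilinearising atlas — Kollár's characteristic-zero order reduction
(`Kollar2007MarkedOrderReduction`, vendored) ⇒ principalization of the boundary ideal by blow-ups in
smooth `ℚ`-centres ⇒ on real points, finitely many blow-up charts composed with sign/orthant box charts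
and power substitutions. -/
def BodiesHaveAtlas : Prop :=
  ∀ (m : ℕ) (K : IntegralRep (m + 3)), Bornology.IsBounded K.domain → (∀ x ∈ K.domain, K.integrand x = 1) →
    ∃ (J : ℕ) (φ : Fin J → (Fin (m + 3) → ℝ) → (Fin (m + 3) → ℝ))
      (φ' : Fin J → (Fin (m + 3) → ℝ) → (Fin (m + 3) → ℝ) →L[ℝ] (Fin (m + 3) → ℝ)),
      IsRectilinearAtlas K.domain J φ φ'

/-- The two statements give the volume dress of X₁ in ambient dimension `≥ 3` (pure logic). -/
theorem boundedBodiesThree_of (hA : AtlasToTame) (hB : BodiesHaveAtlas) :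
    ∀ (m : ℕ) (K : IntegralRep (m + 3)), Bornology.IsBounded K.domain →
      (∀ x ∈ K.domain, K.integrand x = 1) →
      ∃ c ∈ AddSubgroup.closure {d : FormalRep | ∃ (n : ℕ) (r : IntegralRep n),
          r.domain = KZ.cube n ∧ AnalyticOnNhd ℝ r.integrand (KZ.cube n) ∧ d = of r},
        of K - c ∈ relations := by
  intro m K hb h1
  obtain ⟨J, φ, φ', hat⟩ := hB m K hb h1
  exact hA (m + 3) K hb h1 J φ φ' hat

end Summit.KontsevichZagierPeriods.SphericalSchlafli.VolumeForm.KollarAtlas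

end
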